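import Mathlib
import Summits.AtomisticToContinuum.FouriersLaw.Theorems.HoelderEscapeProfileFibreCalculusStubConservationLawIdentities
import HarnessLib

/-!
# Crux `CoercivePulse.PulseCalculus` (stmt-AtomisticToContinuum-15385), line `Sketch` (canonical reduction):
stub `stub_helfandLocal` — the LOCAL Helfand identity from the per-site conservation law

PURE REAL ANALYSIS (`--supports` file; closes nothing). For arbitrary `S G : ℤ → ℝ → ℝ` with each `G(x,·)`
continuous, a majorant `F_τ` of `|G(·,t)|` on every time window `|t| ≤ τ` with `Σ_x (1+x²)F_τ(x) < ∞`,
`Σ_x (1+x²)|S(x,t)| < ∞` at every `t`, and the per-site twice-integrated conservation law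
`S(x,t) − S(x,0) = ∫_{(0,t]} (t−u)(G(x+1,u) − 2G(x,u) + G(x−1,u)) du` (`t > 0`), we prove the `x²`-moment identity
`Σ_x x²S(x,t) − Σ_x x²S(x,0) = 2∫_{(0,t]} (t−u) Σ_x G(x,u) du` — Helfand's "heat diffusion ⇔ current
autocorrelation" identity `M(t) − M(0) = 2∫₀ᵗ(t−u)C_T(u)du` in local form, once `Σ_x G(x,u) = C_T(u)`.
Route: `Σ_x x²(S(x,t)−S(x,0)) = Σ_x ∫_{(0,t]} x²(t−u)ΔG(x,u)du = ∫_{(0,t]} Σ_x x²(t−u)ΔG(x,u)du` (exchange by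
`integral_tsum_of_summable_integral_norm`, the integral norms being dominated through the window majorant by
`t²·x²(F(x+1)+2F(x)+F(x−1))`, summable since `x² ≤ 2(1+(x±1)²)`), and pointwise in `u` the summation by parts
`Σ_x x²ΔG(x,u) = Σ_x((x−1)²−2x²+(x+1)²)G(x,u) = 2Σ_xG(x,u)` (`cli_tsum_mul_laplacian`).
References: E. Helfand, Phys. Rev. 119 (1960) 1–9, §II; Bonetto–Lebowitz–Rey-Bellet (2000) §7.
-/

noncomputable section

namespace Summit.AtomisticToContinuum.FouriersLaw.Theorems.PulseCalculus.CanonicalReduction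

open MeasureTheory Filter Topology Set Function
open Summit.AtomisticToContinuum.FouriersLaw.Theorems.FibreCalculusSketch (cli_tsum_mul_laplacian)

/-- Shifted weighted summability: `Σ_x (1+x²)F(x) < ∞` with `F ≥ 0` gives `Σ_x x²F(e x) < ∞` for a bijection `e`
of `ℤ` with `x² ≤ 2(1+(e x)²)` (used for `e = id, ·+1, ·−1`). [folklore] -/
theorem hl_summable_sq_mul_comp {F : ℤ → ℝ} (hF0 : ∀ x, 0 ≤ F x)
    (hFs : Summable fun x : ℤ => (1 + (x : ℝ) ^ 2) * F x) (e : ℤ ≃ ℤ)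
    (he : ∀ x : ℤ, (x : ℝ) ^ 2 ≤ 2 * (1 + ((e x : ℤ) : ℝ) ^ 2)) :
    Summable fun x : ℤ => (x : ℝ) ^ 2 * F (e x) := by
  refine Summable.of_nonneg_of_le (fun x => mul_nonneg (sq_nonneg _) (hF0 _)) (fun x => ?_)
    ((e.summable_iff.mpr hFs).mul_left 2)
  simp only [Function.comp_apply]
  calc (x : ℝ) ^ 2 * F (e x) ≤ 2 * (1 + ((e x : ℤ) : ℝ) ^ 2) * F (e x) :=
        mul_le_mul_of_nonneg_right (he x) (hF0 _)
    _ = 2 * ((1 + ((e x : ℤ) : ℝ) ^ 2) * F (e x)) := by ring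

/-- From a termwise bound `|g x| ≤ F (e x)` and the shifted weighted summability, `Σ_x x² g(x)` converges
absolutely. [folklore] -/
theorem hl_summable_sq_mul_of_abs_le {F g : ℤ → ℝ} (hF0 : ∀ x, 0 ≤ F x)
    (hFs : Summable fun x : ℤ => (1 + (x : ℝ) ^ 2) * F x) (e : ℤ ≃ ℤ)
    (he : ∀ x : ℤ, (x : ℝ) ^ 2 ≤ 2 * (1 + ((e x : ℤ) : ℝ) ^ 2)) (hg : ∀ x : ℤ, |g x| ≤ F (e x)) :
    Summable fun x : ℤ => (x : ℝ) ^ 2 * g x :=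
  Summable.of_norm_bounded (hl_summable_sq_mul_comp hF0 hFs e he) fun x => by
    rw [Real.norm_eq_abs, abs_mul, abs_of_nonneg (sq_nonneg _)]
    exact mul_le_mul_of_nonneg_left (hg x) (sq_nonneg _)

/-- The three shift inequalities `x² ≤ 2(1+x²)`, `x² ≤ 2(1+(x+1)²)`, `x² ≤ 2(1+(x−1)²)`. [folklore] -/
theorem hl_sq_le_shift (x : ℤ) :
    (x : ℝ) ^ 2 ≤ 2 * (1 + (((Equiv.refl ℤ) x : ℤ) : ℝ) ^ 2) ∧
    (x : ℝ) ^ 2 ≤ 2 * (1 + (((Equiv.addRight (1 : ℤ)) x : ℤ) : ℝ) ^ 2) ∧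
    (x : ℝ) ^ 2 ≤ 2 * (1 + (((Equiv.subRight (1 : ℤ)) x : ℤ) : ℝ) ^ 2) := by
  refine ⟨?_, ?_, ?_⟩
  · simp only [Equiv.refl_apply]
    nlinarith [sq_nonneg (x : ℝ)]
  · simp only [Equiv.coe_addRight]
    push_cast
    nlinarith [sq_nonneg ((x : ℝ) + 2)]
  · simp only [Equiv.subRight_apply]
    push_cast
    nlinarith [sq_nonneg ((x : ℝ) - 2)]

/-- **S3 `stub_helfandLocal`** (registered signature, verbatim; PURE REAL ANALYSIS). The `x²`-moment of the
per-site twice-integrated conservation law: for `t > 0`,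
`Σ_x x²S(x,t) − Σ_x x²S(x,0) = 2∫_{(0,t]}(t−u)Σ_xG(x,u)du`. [cite: Helfand1960, §II] -/
theorem stub_helfandLocal :
    ∀ (S G : ℤ → ℝ → ℝ), (∀ x : ℤ, Continuous (G x)) →
    (∀ τ : ℝ, 0 ≤ τ → ∃ F : ℤ → ℝ, Summable (fun x : ℤ => (1 + (x : ℝ) ^ 2) * F x) ∧
      ∀ t : ℝ, |t| ≤ τ → ∀ x : ℤ, |G x t| ≤ F x) →
    (∀ t : ℝ, Summable (fun x : ℤ => (1 + (x : ℝ) ^ 2) * |S x t|)) →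
    (∀ (x : ℤ) (t : ℝ), 0 < t →
      S x t - S x 0 = ∫ u in Set.Ioc (0:ℝ) t, (t - u) * (G (x + 1) u - 2 * G x u + G (x - 1) u)) →
    ∀ t : ℝ, 0 < t →
      (∑' x : ℤ, (x : ℝ) ^ 2 * S x t) - (∑' x : ℤ, (x : ℝ) ^ 2 * S x 0) =
        2 * ∫ u in Set.Ioc (0:ℝ) t, (t - u) * ∑' x : ℤ, G x u := by
  intro S G hGc hGw hSw hper t ht
  obtain ⟨F, hFs, hFb⟩ := hGw t ht.le
  have hF0 : ∀ x, 0 ≤ F x := fun x => (abs_nonneg _).trans (hFb 0 (by rw [abs_zero]; exact ht.le) x)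
  -- `x²`-weighted summability of `S(·,s)`
  have hsqS : ∀ s : ℝ, Summable fun x : ℤ => (x : ℝ) ^ 2 * S x s := fun s =>
    Summable.of_norm_bounded (hSw s) fun x => by
      rw [Real.norm_eq_abs, abs_mul, abs_of_nonneg (sq_nonneg _)]
      exact mul_le_mul_of_nonneg_right (by nlinarith [sq_nonneg (x : ℝ)]) (abs_nonneg _)
  -- shifted weighted summabilities of the majorant
  have hF1 : Summable fun x : ℤ => (x : ℝ) ^ 2 * F (x + 1) := by
    simpa using hl_summable_sq_mul_comp hF0 hFs (Equiv.addRight (1 : ℤ)) (fun x => (hl_sq_le_shift x).2.1)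
  have hF0' : Summable fun x : ℤ => (x : ℝ) ^ 2 * F x := by
    simpa using hl_summable_sq_mul_comp hF0 hFs (Equiv.refl ℤ) (fun x => (hl_sq_le_shift x).1)
  have hF2 : Summable fun x : ℤ => (x : ℝ) ^ 2 * F (x - 1) := by
    simpa using hl_summable_sq_mul_comp hF0 hFs (Equiv.subRight (1 : ℤ)) (fun x => (hl_sq_le_shift x).2.2)
  have hK : Summable fun x : ℤ => (x : ℝ) ^ 2 * (F (x + 1) + 2 * F x + F (x - 1)) := by
    refine ((hF1.add (hF0'.mul_left 2)).add hF2).congr fun x => ?_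
    ring
  -- the integrands of the exchange
  set Φ : ℤ → ℝ → ℝ := fun x u =>
    (x : ℝ) ^ 2 * ((t - u) * (G (x + 1) u - 2 * G x u + G (x - 1) u)) with hΦ
  have hΦc : ∀ x : ℤ, Continuous (Φ x) := by
    intro x
    have h1 := hGc (x + 1); have h2 := hGc x; have h3 := hGc (x - 1)
    simp only [hΦ]
    fun_prop
  have hΦi : ∀ x : ℤ, IntegrableOn (Φ x) (Ioc (0:ℝ) t) := fun x =>
    (hΦc x).integrableOn_Icc.mono_set Ioc_subset_Icc_self
  have hΦb : ∀ x : ℤ, ∀ u ∈ Ioc (0:ℝ) t,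
      ‖Φ x u‖ ≤ t * ((x : ℝ) ^ 2 * (F (x + 1) + 2 * F x + F (x - 1))) := by
    intro x u hu
    have hu1 : |u| ≤ t := by rw [abs_of_pos hu.1]; exact hu.2
    have h1 := hFb u hu1 (x + 1); have h2 := hFb u hu1 x; have h3 := hFb u hu1 (x - 1)
    have htu : |t - u| ≤ t := by
      rw [abs_of_nonneg (by linarith [hu.2])]
      linarith [hu.1]
    have hΔ : |G (x + 1) u - 2 * G x u + G (x - 1) u| ≤ F (x + 1) + 2 * F x + F (x - 1) := by
      have e2 : |2 * G x u| = 2 * |G x u| := by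
        rw [abs_mul, abs_of_pos (by norm_num : (0:ℝ) < 2)]
      calc |G (x + 1) u - 2 * G x u + G (x - 1) u|
          ≤ |G (x + 1) u - 2 * G x u| + |G (x - 1) u| := abs_add_le _ _
        _ ≤ |G (x + 1) u| + |2 * G x u| + |G (x - 1) u| := by
            gcongr
            exact abs_sub _ _
        _ ≤ F (x + 1) + 2 * F x + F (x - 1) := by rw [e2]; linarith
    rw [Real.norm_eq_abs]
    simp only [hΦ]
    rw [abs_mul, abs_mul, abs_of_nonneg (sq_nonneg _)]
    calc (x : ℝ) ^ 2 * (|t - u| * |G (x + 1) u - 2 * G x u + G (x - 1) u|)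
        ≤ (x : ℝ) ^ 2 * (t * (F (x + 1) + 2 * F x + F (x - 1))) :=
          mul_le_mul_of_nonneg_left (mul_le_mul htu hΔ (abs_nonneg _) ht.le) (sq_nonneg _)
      _ = t * ((x : ℝ) ^ 2 * (F (x + 1) + 2 * F x + F (x - 1))) := by ring
  -- summable integral norms
  have hconst : ∀ c : ℝ, IntegrableOn (fun _ : ℝ => c) (Ioc (0:ℝ) t) := fun c =>
    (continuous_const.integrableOn_Icc (a := 0) (b := t)).mono_set Ioc_subset_Icc_self
  have hvol : (volume (Ioc (0:ℝ) t)).toReal = t := by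
    rw [Real.volume_Ioc, sub_zero, ENNReal.toReal_ofReal ht.le]
  have hΦn : Summable fun x : ℤ => ∫ u in Ioc (0:ℝ) t, ‖Φ x u‖ := by
    refine Summable.of_nonneg_of_le (fun x => integral_nonneg fun u => norm_nonneg _) (fun x => ?_)
      ((hK.mul_left t).mul_left t)
    calc ∫ u in Ioc (0:ℝ) t, ‖Φ x u‖
        ≤ ∫ u in Ioc (0:ℝ) t, t * ((x : ℝ) ^ 2 * (F (x + 1) + 2 * F x + F (x - 1))) :=
          setIntegral_mono_on (hΦi x).norm (hconst _) measurableSet_Ioc (hΦb x)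
      _ = t * (t * ((x : ℝ) ^ 2 * (F (x + 1) + 2 * F x + F (x - 1)))) := by
          rw [setIntegral_const, Measure.real, hvol, smul_eq_mul]
  -- the exchange `Σ_x ∫ = ∫ Σ_x`
  have hex : ∑' x : ℤ, ∫ u in Ioc (0:ℝ) t, Φ x u = ∫ u in Ioc (0:ℝ) t, ∑' x : ℤ, Φ x u :=
    integral_tsum_of_summable_integral_norm hΦi hΦn
  -- summation by parts, pointwise in `u ∈ (0, t]`
  have hpt : ∀ u ∈ Ioc (0:ℝ) t, ∑' x : ℤ, Φ x u = 2 * ((t - u) * ∑' x : ℤ, G x u) := by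
    intro u hu
    have hu1 : |u| ≤ t := by rw [abs_of_pos hu.1]; exact hu.2
    have hG1 : Summable fun x : ℤ => (x : ℝ) ^ 2 * G (x + 1) u :=
      hl_summable_sq_mul_of_abs_le hF0 hFs (Equiv.addRight (1 : ℤ)) (fun x => (hl_sq_le_shift x).2.1)
        fun x => by simpa using hFb u hu1 (x + 1)
    have hG0 : Summable fun x : ℤ => (x : ℝ) ^ 2 * G x u :=
      hl_summable_sq_mul_of_abs_le hF0 hFs (Equiv.refl ℤ) (fun x => (hl_sq_le_shift x).1)
        fun x => by simpa using hFb u hu1 x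
    have hG2 : Summable fun x : ℤ => (x : ℝ) ^ 2 * G (x - 1) u :=
      hl_summable_sq_mul_of_abs_le hF0 hFs (Equiv.subRight (1 : ℤ)) (fun x => (hl_sq_le_shift x).2.2)
        fun x => by simpa using hFb u hu1 (x - 1)
    have hlap := cli_tsum_mul_laplacian (fun x : ℤ => ((x : ℤ) : ℝ) ^ 2) (fun x : ℤ => G x u) hG1 hG0 hG2
    beta_reduce at hlap
    calc ∑' x : ℤ, Φ x u
        = ∑' x : ℤ, (t - u) * ((x : ℝ) ^ 2 * (G (x + 1) u - 2 * G x u + G (x - 1) u)) :=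
          tsum_congr fun x => by simp only [hΦ]; ring
      _ = (t - u) * ∑' x : ℤ, (x : ℝ) ^ 2 * (G (x + 1) u - 2 * G x u + G (x - 1) u) := tsum_mul_left
      _ = (t - u) * ∑' x : ℤ, ((((x - 1 : ℤ)) : ℝ) ^ 2 - 2 * (x : ℝ) ^ 2 + (((x + 1 : ℤ)) : ℝ) ^ 2) * G x u := by
          rw [hlap]
      _ = (t - u) * ∑' x : ℤ, 2 * G x u := by
          congr 1
          refine tsum_congr fun x => ?_
          push_cast
          ring
      _ = 2 * ((t - u) * ∑' x : ℤ, G x u) := by rw [tsum_mul_left]; ring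
  -- assemble
  calc (∑' x : ℤ, (x : ℝ) ^ 2 * S x t) - (∑' x : ℤ, (x : ℝ) ^ 2 * S x 0)
      = ∑' x : ℤ, ((x : ℝ) ^ 2 * S x t - (x : ℝ) ^ 2 * S x 0) := ((hsqS t).tsum_sub (hsqS 0)).symm
    _ = ∑' x : ℤ, ∫ u in Ioc (0:ℝ) t, Φ x u := by
        refine tsum_congr fun x => ?_
        rw [← mul_sub, hper x t ht]
        simp only [hΦ]
        exact (integral_const_mul _ _).symm
    _ = ∫ u in Ioc (0:ℝ) t, ∑' x : ℤ, Φ x u := hex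
    _ = ∫ u in Ioc (0:ℝ) t, 2 * ((t - u) * ∑' x : ℤ, G x u) := setIntegral_congr_fun measurableSet_Ioc hpt
    _ = 2 * ∫ u in Set.Ioc (0:ℝ) t, (t - u) * ∑' x : ℤ, G x u := integral_const_mul _ _

end Summit.AtomisticToContinuum.FouriersLaw.Theorems.PulseCalculus.CanonicalReduction

end
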